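import Summits.NavierStokesRegularity.NavierStokesRegularity.Theorems.PerpetualPumpThesisLocalExistenceOps
import Summits.NavierStokesRegularity.NavierStokesRegularity.Theorems.PerpetualPumpThesisLocalExistenceDuhamel

/-!
# Stub E (`localExistence`) for `PerpetualPump.Thesis`, part III: one step of the lifted Picard
# iteration

Support file (part 3 of the stub `localExistence` of line `SketchIdeator2`, crux
stmt-NavierStokesRegularity-1832). Tao's local `H¹⁰` theory for `∂ₜu = Δu + B̃(u,u)`
(J. Amer. Math. Soc. 29 (2016), arXiv:1402.0290v3, §1.1 after (1.15)) is run on the lifted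
level `g = ⟨D⟩¹⁰u`: given a bilinear representative `Bop` of `B̃` with the tame bound
`‖Bop(u,v)‖_{H⁹} ≤ K‖u‖_{H¹⁰}‖v‖_{H¹⁰}` on `H¹⁰_df`, and the operator toolkit `(J, P, L)` of part I
(`J = ⟨D⟩⁻¹⁰`, `P_σ = ⟨D⟩e^{σΔ}`, `L = ⟨D⟩⁹`), the **lifted Duhamel map** is
`Φ(g)(t) = e^{rΔ} g_a + ∫₀ʳ P_{r-s} L(Bop(Jg(s), Jg(s))) ds`, `r = max 0 (min t τ)` (clamped clock).
For curves `g` that are continuous, bounded by `M` and with `Jg(t) ∈ H¹⁰_df`, this file proves: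

* the lifted forcing `G(s) = L(Bop(Jg(s), Jg(s)))` is continuous with `‖G‖ ≤ KM²` and
  `‖G − G'‖ ≤ 2KM‖g − g'‖` (bilinearity);
* `Φ(g)` is again such a curve: continuous (part II), bounded by `R + KM²η ≤ M` where
  `η` bounds `∫₀ʳ(1+σ^{-1/2})dσ` on `[0,τ]`, and `JΦ(g)(t) = e^{rΔ}a + ∫₀ʳ e^{(r-s)Δ}Bop(u,u) ds`
  is real and divergence free (registered sub-goal `stub_localExistence_Step`);
* the contraction estimate `‖Φ(g)(t) − Φ(g')(t)‖ ≤ 2KMη · sup‖g − g'‖`.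

## References

* T. Tao, J. Amer. Math. Soc. 29 (2016), 601–674, arXiv:1402.0290v3, §1.1 (1.15).
-/

noncomputable section

open MeasureTheory Set Filter Topology
open scoped ENNReal NNReal Interval

set_option linter.dupNamespace false

namespace Summit.NavierStokesRegularity.NavierStokesRegularity.Theorems.PerpetualPumpThesis.E

open Literature.Analysis.FluidPDE Literature.Analysis.FluidPDE.Tao2016
open Literature.Analysis.FunctionSpaces (eFourierSobolevNorm)
open Summit.NavierStokesRegularity.NavierStokesRegularity.Theorems.PerpetualPumpEulerTypeIGlue
  (continuous_heat_apply norm_heat_le)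

/-! ### The lifted forcing `G = L(Bop(Jg, Jg))` -/

/-- `J x ∈ H¹⁰_df` as soon as it is real and divergence free (`‖J x‖_{H¹⁰} = ‖x‖ < ∞`). -/
theorem memH10df_j {J : L2C →L[ℂ] L2C} (hJn : ∀ h : L2C, eFourierSobolevNorm 10 (J h) = ‖h‖ₑ)
    {x : L2C} (hx : IsReal (J x) ∧ IsFourierDivFree (J x)) : MemH10df (J x) :=
  ⟨by rw [hJn]; exact enorm_lt_top, hx.1, hx.2⟩

/-- The tame bound makes `Bop(u,v)` an `H⁹` field for `u, v ∈ H¹⁰_df`. -/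
theorem bop_lt_top {Bop : L2C → L2C → L2C} {K : ℝ}
    (hB9 : ∀ u v : L2C, MemH10df u → MemH10df v → eFourierSobolevNorm 9 (Bop u v) ≤
      ENNReal.ofReal K * eFourierSobolevNorm 10 u * eFourierSobolevNorm 10 v)
    {u v : L2C} (hu : MemH10df u) (hv : MemH10df v) : eFourierSobolevNorm 9 (Bop u v) < ⊤ :=
  (hB9 u v hu hv).trans_lt (ENNReal.mul_lt_top (ENNReal.mul_lt_top ENNReal.ofReal_lt_top hu.1) hv.1)

/-- **Bilinearity, difference form**: `Bop(u,u) − Bop(u',u') = Bop(u−u',u) + Bop(u',u−u')`. -/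
theorem bop_sub_bop {Bop : L2C → L2C → L2C}
    (hBadd : ∀ u u' v : L2C, MemH10df u → MemH10df u' → MemH10df v →
      Bop (u + u') v = Bop u v + Bop u' v ∧ Bop v (u + u') = Bop v u + Bop v u')
    {u u' : L2C} (hu : MemH10df u) (hu' : MemH10df u') :
    Bop u u - Bop u' u' = Bop (u - u') u + Bop u' (u - u') := by
  have h1 := (hBadd (u - u') u' u (hu.sub hu') hu' hu).1
  have h2 := (hBadd (u - u') u' u' (hu.sub hu') hu' hu').2
  rw [sub_add_cancel] at h1 h2
  rw [h1, h2]
  abel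

/-- Scalar bookkeeping: `K ‖a‖ₑ ‖b‖ₑ = ofReal (K ‖a‖ ‖b‖)`. -/
theorem ofReal_mul_enorm_enorm {K : ℝ} (hK : 0 ≤ K) (a b : L2C) :
    ENNReal.ofReal K * ‖a‖ₑ * ‖b‖ₑ = ENNReal.ofReal (K * (‖a‖ * ‖b‖)) := by
  rw [ENNReal.ofReal_mul hK, ENNReal.ofReal_mul (norm_nonneg a), ofReal_norm, ofReal_norm, mul_assoc]

/-- **The lifted forcing is bounded**: `‖L(Bop(Jx, Jx))‖ ≤ K‖x‖²`. -/
theorem norm_lift_bop_le {Bop : L2C → L2C → L2C} {K : ℝ} (hK : 0 ≤ K)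
    (hB9 : ∀ u v : L2C, MemH10df u → MemH10df v → eFourierSobolevNorm 9 (Bop u v) ≤
      ENNReal.ofReal K * eFourierSobolevNorm 10 u * eFourierSobolevNorm 10 v)
    {J : L2C →L[ℂ] L2C} (hJn : ∀ h : L2C, eFourierSobolevNorm 10 (J h) = ‖h‖ₑ)
    {L : L2C → L2C} (hLn : ∀ F : L2C, eFourierSobolevNorm 9 F < ⊤ → ‖L F‖ₑ = eFourierSobolevNorm 9 F)
    {x : L2C} (hx : IsReal (J x) ∧ IsFourierDivFree (J x)) :
    ‖L (Bop (J x) (J x))‖ ≤ K * (‖x‖ * ‖x‖) := by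
  have hx' := memH10df_j hJn hx
  have h : ‖L (Bop (J x) (J x))‖ₑ ≤ ENNReal.ofReal (K * (‖x‖ * ‖x‖)) := by
    rw [hLn _ (bop_lt_top hB9 hx' hx'), ← ofReal_mul_enorm_enorm hK, ← hJn x]
    exact hB9 _ _ hx' hx'
  rw [← ofReal_norm] at h
  exact (ENNReal.ofReal_le_ofReal_iff (by positivity)).1 h

/-- **The lifted forcing is locally Lipschitz**:
`‖L(Bop(Jx,Jx)) − L(Bop(Jy,Jy))‖ ≤ K(‖x−y‖‖x‖ + ‖y‖‖x−y‖)`. -/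
theorem norm_lift_bop_sub_le {Bop : L2C → L2C → L2C} {K : ℝ} (hK : 0 ≤ K)
    (hB9 : ∀ u v : L2C, MemH10df u → MemH10df v → eFourierSobolevNorm 9 (Bop u v) ≤
      ENNReal.ofReal K * eFourierSobolevNorm 10 u * eFourierSobolevNorm 10 v)
    (hBadd : ∀ u u' v : L2C, MemH10df u → MemH10df u' → MemH10df v →
      Bop (u + u') v = Bop u v + Bop u' v ∧ Bop v (u + u') = Bop v u + Bop v u')
    {J : L2C →L[ℂ] L2C} (hJn : ∀ h : L2C, eFourierSobolevNorm 10 (J h) = ‖h‖ₑ)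
    {L : L2C → L2C}
    (hLsub : ∀ F F' : L2C, eFourierSobolevNorm 9 F < ⊤ → eFourierSobolevNorm 9 F' < ⊤ →
      ‖L F - L F'‖ₑ = eFourierSobolevNorm 9 (F - F'))
    {x y : L2C} (hx : IsReal (J x) ∧ IsFourierDivFree (J x))
    (hy : IsReal (J y) ∧ IsFourierDivFree (J y)) :
    ‖L (Bop (J x) (J x)) - L (Bop (J y) (J y))‖ ≤ K * (‖x - y‖ * ‖x‖) + K * (‖y‖ * ‖x - y‖) := by
  have hx' := memH10df_j hJn hx
  have hy' := memH10df_j hJn hy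
  have hxy : MemH10df (J x - J y) := hx'.sub hy'
  have h : ‖L (Bop (J x) (J x)) - L (Bop (J y) (J y))‖ₑ ≤
      ENNReal.ofReal (K * (‖x - y‖ * ‖x‖) + K * (‖y‖ * ‖x - y‖)) := by
    rw [hLsub _ _ (bop_lt_top hB9 hx' hx') (bop_lt_top hB9 hy' hy'), bop_sub_bop hBadd hx' hy',
      ENNReal.ofReal_add (by positivity) (by positivity), ← ofReal_mul_enorm_enorm hK,
      ← ofReal_mul_enorm_enorm hK, ← hJn x, ← hJn y, ← hJn (x - y), map_sub]
    exact (eFourierSobolevNorm_add_le _ _ _).trans (add_le_add (hB9 _ _ hxy hx') (hB9 _ _ hy' hxy))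
  rw [← ofReal_norm] at h
  exact (ENNReal.ofReal_le_ofReal_iff (by positivity)).1 h

/-- **The lifted forcing along a curve is continuous** when the curve is continuous, bounded and
`H¹⁰_df`-valued under `J`. -/
theorem continuous_lift_bop {Bop : L2C → L2C → L2C} {K : ℝ} (hK : 0 ≤ K)
    (hB9 : ∀ u v : L2C, MemH10df u → MemH10df v → eFourierSobolevNorm 9 (Bop u v) ≤
      ENNReal.ofReal K * eFourierSobolevNorm 10 u * eFourierSobolevNorm 10 v)
    (hBadd : ∀ u u' v : L2C, MemH10df u → MemH10df u' → MemH10df v →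
      Bop (u + u') v = Bop u v + Bop u' v ∧ Bop v (u + u') = Bop v u + Bop v u')
    {J : L2C →L[ℂ] L2C} (hJn : ∀ h : L2C, eFourierSobolevNorm 10 (J h) = ‖h‖ₑ)
    {L : L2C → L2C}
    (hLsub : ∀ F F' : L2C, eFourierSobolevNorm 9 F < ⊤ → eFourierSobolevNorm 9 F' < ⊤ →
      ‖L F - L F'‖ₑ = eFourierSobolevNorm 9 (F - F'))
    {M : ℝ} (hM : 0 ≤ M) {g : ℝ → L2C} (hg : Continuous g) (hgb : ∀ s, ‖g s‖ ≤ M)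
    (hgr : ∀ s, IsReal (J (g s)) ∧ IsFourierDivFree (J (g s))) :
    Continuous fun s => L (Bop (J (g s)) (J (g s))) := by
  rw [Metric.continuous_iff]
  intro s₀ ε hε
  obtain ⟨δ, hδ, hδ'⟩ := Metric.continuous_iff.1 hg s₀ (ε / (2 * K * M + 1)) (by positivity)
  refine ⟨δ, hδ, fun s hs => ?_⟩
  have hd := hδ' s hs
  rw [dist_eq_norm] at hd ⊢
  have hd0 : 0 ≤ ‖g s - g s₀‖ := norm_nonneg _
  calc ‖L (Bop (J (g s)) (J (g s))) - L (Bop (J (g s₀)) (J (g s₀)))‖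
      ≤ K * (‖g s - g s₀‖ * ‖g s‖) + K * (‖g s₀‖ * ‖g s - g s₀‖) :=
        norm_lift_bop_sub_le hK hB9 hBadd hJn hLsub (hgr s) (hgr s₀)
    _ ≤ K * (‖g s - g s₀‖ * M) + K * (M * ‖g s - g s₀‖) := by
        gcongr
        · exact hgb s
        · exact hgb s₀
    _ = (2 * K * M) * ‖g s - g s₀‖ := by ring
    _ ≤ (2 * K * M + 1) * ‖g s - g s₀‖ := by nlinarith
    _ < (2 * K * M + 1) * (ε / (2 * K * M + 1)) := mul_lt_mul_of_pos_left hd (by positivity)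
    _ = ε := by field_simp

/-! ### The clock bound -/

/-- **Choice of the lifespan**: the primitive `∫₀ʳ (1 + σ^{-1/2}) dσ` is continuous and vanishes
at `r = 0`, so it is `≤ η` on a short interval `[0, τ]`, `0 < τ ≤ 1`. -/
theorem exists_clock_bound {η : ℝ} (hη : 0 < η) : ∃ τ : ℝ, 0 < τ ∧ τ ≤ 1 ∧
    ∀ r ∈ Icc (0 : ℝ) τ, |∫ σ in (0 : ℝ)..r, (1 + σ ^ (-(1 / 2 : ℝ)))| ≤ η := by
  have hβc : Continuous fun t => ∫ σ in (0 : ℝ)..t, (1 + σ ^ (-(1 / 2 : ℝ))) :=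
    intervalIntegral.continuous_primitive intervalIntegrable_one_add_rpow 0
  obtain ⟨δ, hδ, hδ'⟩ := Metric.continuous_iff.1 hβc 0 η hη
  refine ⟨min (δ / 2) 1, by positivity, min_le_right _ _, fun r hr => ?_⟩
  have hrδ : dist r 0 < δ := by
    rw [Real.dist_eq, sub_zero, abs_of_nonneg hr.1]
    exact lt_of_le_of_lt (hr.2.trans (min_le_left _ _)) (half_lt_self hδ)
  have h := hδ' r hrδ
  rw [Real.dist_eq, intervalIntegral.integral_same, sub_zero] at h
  exact h.le

/-! ### The lifted Duhamel map `Φ` -/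

/-- **`Φ(g)` is bounded**: at a clock value `r ∈ [0, τ]`,
`‖e^{rΔ}g_a + ∫₀ʳ P_{r-s} G(s) ds‖ ≤ R + K M² η`. -/
theorem norm_phi_le {Bop : L2C → L2C → L2C} {K : ℝ} (hK : 0 ≤ K)
    (hB9 : ∀ u v : L2C, MemH10df u → MemH10df v → eFourierSobolevNorm 9 (Bop u v) ≤
      ENNReal.ofReal K * eFourierSobolevNorm 10 u * eFourierSobolevNorm 10 v)
    {J : L2C →L[ℂ] L2C} (hJn : ∀ h : L2C, eFourierSobolevNorm 10 (J h) = ‖h‖ₑ)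
    {L : L2C → L2C} (hLn : ∀ F : L2C, eFourierSobolevNorm 9 F < ⊤ → ‖L F‖ₑ = eFourierSobolevNorm 9 F)
    {P : ℝ → (L2C →L[ℂ] L2C)} (hPb : ∀ σ : ℝ, 0 < σ → ‖P σ‖ ≤ 1 + σ ^ (-(1 / 2 : ℝ)))
    {M : ℝ} (hM : 0 ≤ M) {g : ℝ → L2C} (hgb : ∀ s, ‖g s‖ ≤ M)
    (hgr : ∀ s, IsReal (J (g s)) ∧ IsFourierDivFree (J (g s)))
    {ga : L2C} {R : ℝ} (hga : ‖ga‖ ≤ R) {τ η : ℝ}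
    (hβ : ∀ r ∈ Icc (0 : ℝ) τ, |∫ σ in (0 : ℝ)..r, (1 + σ ^ (-(1 / 2 : ℝ)))| ≤ η)
    {r : ℝ} (hr : r ∈ Icc (0 : ℝ) τ) :
    ‖heat r ga + ∫ s in (0 : ℝ)..r, P (r - s) (L (Bop (J (g s)) (J (g s))))‖ ≤
      R + K * (M * M) * η := by
  refine (norm_add_le _ _).trans (add_le_add ((norm_heat_le r ga).trans hga) ?_)
  rw [integral_smoothing_comp_sub]
  refine (norm_integral_smoothing_le hPb r (fun s => L (Bop (J (g s)) (J (g s)))) le_rfl hr.1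
    (N := K * (M * M)) (by positivity) fun σ _ => ?_).trans ?_
  · exact (norm_lift_bop_le hK hB9 hJn hLn (hgr _)).trans
      (mul_le_mul_of_nonneg_left (mul_le_mul (hgb _) (hgb _) (norm_nonneg _) hM) hK)
  · exact mul_le_mul_of_nonneg_left (hβ r hr) (by positivity)

/-- The Duhamel integrand `s ↦ P_{r-s} G(s)` of `Φ(g)` is interval integrable on `[0, r]`. -/
theorem intervalIntegrable_phi {Bop : L2C → L2C → L2C} {K : ℝ} (hK : 0 ≤ K)
    (hB9 : ∀ u v : L2C, MemH10df u → MemH10df v → eFourierSobolevNorm 9 (Bop u v) ≤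
      ENNReal.ofReal K * eFourierSobolevNorm 10 u * eFourierSobolevNorm 10 v)
    (hBadd : ∀ u u' v : L2C, MemH10df u → MemH10df u' → MemH10df v →
      Bop (u + u') v = Bop u v + Bop u' v ∧ Bop v (u + u') = Bop v u + Bop v u')
    {J : L2C →L[ℂ] L2C} (hJn : ∀ h : L2C, eFourierSobolevNorm 10 (J h) = ‖h‖ₑ)
    {L : L2C → L2C}
    (hLsub : ∀ F F' : L2C, eFourierSobolevNorm 9 F < ⊤ → eFourierSobolevNorm 9 F' < ⊤ →
      ‖L F - L F'‖ₑ = eFourierSobolevNorm 9 (F - F'))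
    (hLn : ∀ F : L2C, eFourierSobolevNorm 9 F < ⊤ → ‖L F‖ₑ = eFourierSobolevNorm 9 F)
    {P : ℝ → (L2C →L[ℂ] L2C)} (hPb : ∀ σ : ℝ, 0 < σ → ‖P σ‖ ≤ 1 + σ ^ (-(1 / 2 : ℝ)))
    (hPf : ∀ ρ σ : ℝ, 0 < ρ → ρ ≤ σ → ∀ h : L2C, P σ h = heat (σ - ρ) (P ρ h))
    {M : ℝ} (hM : 0 ≤ M) {g : ℝ → L2C} (hg : Continuous g) (hgb : ∀ s, ‖g s‖ ≤ M)
    (hgr : ∀ s, IsReal (J (g s)) ∧ IsFourierDivFree (J (g s))) {r : ℝ} (hr : 0 ≤ r) :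
    IntervalIntegrable (fun s => P (r - s) (L (Bop (J (g s)) (J (g s))))) volume 0 r :=
  intervalIntegrable_smoothing_sub hPb hPf (continuous_lift_bop hK hB9 hBadd hJn hLsub hM hg hgb hgr)
    hr (N := K * (M * M)) (fun s => (norm_lift_bop_le hK hB9 hJn hLn (hgr s)).trans
      (mul_le_mul_of_nonneg_left (mul_le_mul (hgb _) (hgb _) (norm_nonneg _) hM) hK))

/-- **`Φ(g)` under `J`, the physical Duhamel formula**:
`J(e^{rΔ}g_a + ∫₀ʳ P_{r-s} G(s) ds) = e^{rΔ}a + ∫₀ʳ J P_{r-s} G(s) ds`. -/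
theorem j_phi_eq {J : L2C →L[ℂ] L2C} (hJh : ∀ (τ : ℝ) (h : L2C), J (heat τ h) = heat τ (J h))
    {P : ℝ → (L2C →L[ℂ] L2C)} {G : ℝ → L2C} {r : ℝ}
    (hI : IntervalIntegrable (fun s => P (r - s) (G s)) volume 0 r)
    {ga a : L2C} (hJa : J ga = a) :
    J (heat r ga + ∫ s in (0 : ℝ)..r, P (r - s) (G s)) =
      heat r a + ∫ s in (0 : ℝ)..r, J (P (r - s) (G s)) := by
  rw [map_add, hJh, hJa, ← J.intervalIntegral_comp_comm hI]

/-- **The physical Duhamel integrand is `H¹⁰_df`-valued**: for `s ∈ (0, r)`,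
`J P_{r-s} L(Bop(u,u)) = e^{(r-s)Δ} Bop(u,u)` is real and divergence free, and it vanishes at
`s = r`. -/
theorem jp_isReal_isFourierDivFree {Bop : L2C → L2C → L2C} {K : ℝ}
    (hB9 : ∀ u v : L2C, MemH10df u → MemH10df v → eFourierSobolevNorm 9 (Bop u v) ≤
      ENNReal.ofReal K * eFourierSobolevNorm 10 u * eFourierSobolevNorm 10 v)
    (hBrd : ∀ u v : L2C, MemH10df u → MemH10df v → IsReal (Bop u v) ∧ IsFourierDivFree (Bop u v))
    {J : L2C →L[ℂ] L2C} (hJn : ∀ h : L2C, eFourierSobolevNorm 10 (J h) = ‖h‖ₑ)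
    {L : L2C → L2C} {P : ℝ → (L2C →L[ℂ] L2C)} (hP0 : ∀ σ : ℝ, σ ≤ 0 → P σ = 0)
    (hJPL : ∀ σ : ℝ, 0 < σ → ∀ F : L2C, eFourierSobolevNorm 9 F < ⊤ → J (P σ (L F)) = heat σ F)
    {g : ℝ → L2C} (hgr : ∀ s, IsReal (J (g s)) ∧ IsFourierDivFree (J (g s)))
    {r s : ℝ} (hr : 0 ≤ r) (hs : s ∈ Ι (0 : ℝ) r) :
    IsReal (J (P (r - s) (L (Bop (J (g s)) (J (g s)))))) ∧
      IsFourierDivFree (J (P (r - s) (L (Bop (J (g s)) (J (g s)))))) := by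
  rw [uIoc_of_le hr] at hs
  rcases hs.2.lt_or_eq with hlt | heq
  · have hσ : 0 < r - s := sub_pos.2 hlt
    have hu := memH10df_j hJn (hgr s)
    rw [hJPL _ hσ _ (bop_lt_top hB9 hu hu)]
    exact ⟨(hBrd _ _ hu hu).1.heat _, (hBrd _ _ hu hu).2.heat _⟩
  · rw [heq, sub_self, hP0 0 le_rfl, zero_apply, map_zero]
    exact ⟨isReal_zero, memH10df_zero.2.2⟩

/-- **`Φ(g)` is `H¹⁰_df`-valued under `J`**: `J Φ(g)(t) = e^{rΔ}a + ∫₀ʳ e^{(r-s)Δ}Bop(u,u) ds` is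
real and divergence free (heat flow and Bochner integrals preserve both). -/
theorem j_phi_isReal_isFourierDivFree {Bop : L2C → L2C → L2C} {K : ℝ} (hK : 0 ≤ K)
    (hB9 : ∀ u v : L2C, MemH10df u → MemH10df v → eFourierSobolevNorm 9 (Bop u v) ≤
      ENNReal.ofReal K * eFourierSobolevNorm 10 u * eFourierSobolevNorm 10 v)
    (hBrd : ∀ u v : L2C, MemH10df u → MemH10df v → IsReal (Bop u v) ∧ IsFourierDivFree (Bop u v))
    (hBadd : ∀ u u' v : L2C, MemH10df u → MemH10df u' → MemH10df v →
      Bop (u + u') v = Bop u v + Bop u' v ∧ Bop v (u + u') = Bop v u + Bop v u')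
    {J : L2C →L[ℂ] L2C} (hJn : ∀ h : L2C, eFourierSobolevNorm 10 (J h) = ‖h‖ₑ)
    (hJh : ∀ (τ : ℝ) (h : L2C), J (heat τ h) = heat τ (J h))
    {L : L2C → L2C}
    (hLsub : ∀ F F' : L2C, eFourierSobolevNorm 9 F < ⊤ → eFourierSobolevNorm 9 F' < ⊤ →
      ‖L F - L F'‖ₑ = eFourierSobolevNorm 9 (F - F'))
    (hLn : ∀ F : L2C, eFourierSobolevNorm 9 F < ⊤ → ‖L F‖ₑ = eFourierSobolevNorm 9 F)
    {P : ℝ → (L2C →L[ℂ] L2C)} (hPb : ∀ σ : ℝ, 0 < σ → ‖P σ‖ ≤ 1 + σ ^ (-(1 / 2 : ℝ)))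
    (hP0 : ∀ σ : ℝ, σ ≤ 0 → P σ = 0)
    (hPf : ∀ ρ σ : ℝ, 0 < ρ → ρ ≤ σ → ∀ h : L2C, P σ h = heat (σ - ρ) (P ρ h))
    (hJPL : ∀ σ : ℝ, 0 < σ → ∀ F : L2C, eFourierSobolevNorm 9 F < ⊤ → J (P σ (L F)) = heat σ F)
    {M : ℝ} (hM : 0 ≤ M) {g : ℝ → L2C} (hg : Continuous g) (hgb : ∀ s, ‖g s‖ ≤ M)
    (hgr : ∀ s, IsReal (J (g s)) ∧ IsFourierDivFree (J (g s)))
    {ga a : L2C} (hJa : J ga = a) (ha : MemH10df a) {r : ℝ} (hr : 0 ≤ r) :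
    IsReal (J (heat r ga + ∫ s in (0 : ℝ)..r, P (r - s) (L (Bop (J (g s)) (J (g s)))))) ∧
      IsFourierDivFree (J (heat r ga + ∫ s in (0 : ℝ)..r, P (r - s) (L (Bop (J (g s)) (J (g s)))))) := by
  have hI := intervalIntegrable_phi hK hB9 hBadd hJn hLsub hLn hPb hPf hM hg hgb hgr hr
  rw [j_phi_eq hJh hI hJa]
  have hI' : IntervalIntegrable (fun s => J (P (r - s) (L (Bop (J (g s)) (J (g s)))))) volume 0 r :=
    ⟨J.integrable_comp hI.1, J.integrable_comp hI.2⟩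
  exact ⟨(ha.2.1.heat r).add (isReal_intervalIntegral hI' fun s hs =>
      (jp_isReal_isFourierDivFree hB9 hBrd hJn hP0 hJPL hgr hr hs).1),
    (ha.2.2.heat r).add (isFourierDivFree_intervalIntegral hI' fun s hs =>
      (jp_isReal_isFourierDivFree hB9 hBrd hJn hP0 hJPL hgr hr hs).2)⟩

/-- **`Φ(g)` is continuous in time** (the clamped clock `r = max 0 (min t τ)` is continuous, the
heat orbit of `g_a` is continuous, and the Duhamel integral is continuous on `[0, ∞)` by part II). -/
theorem continuous_phi {Bop : L2C → L2C → L2C} {K : ℝ} (hK : 0 ≤ K)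
    (hB9 : ∀ u v : L2C, MemH10df u → MemH10df v → eFourierSobolevNorm 9 (Bop u v) ≤
      ENNReal.ofReal K * eFourierSobolevNorm 10 u * eFourierSobolevNorm 10 v)
    (hBadd : ∀ u u' v : L2C, MemH10df u → MemH10df u' → MemH10df v →
      Bop (u + u') v = Bop u v + Bop u' v ∧ Bop v (u + u') = Bop v u + Bop v u')
    {J : L2C →L[ℂ] L2C} (hJn : ∀ h : L2C, eFourierSobolevNorm 10 (J h) = ‖h‖ₑ)
    {L : L2C → L2C}
    (hLsub : ∀ F F' : L2C, eFourierSobolevNorm 9 F < ⊤ → eFourierSobolevNorm 9 F' < ⊤ →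
      ‖L F - L F'‖ₑ = eFourierSobolevNorm 9 (F - F'))
    (hLn : ∀ F : L2C, eFourierSobolevNorm 9 F < ⊤ → ‖L F‖ₑ = eFourierSobolevNorm 9 F)
    {P : ℝ → (L2C →L[ℂ] L2C)} (hPb : ∀ σ : ℝ, 0 < σ → ‖P σ‖ ≤ 1 + σ ^ (-(1 / 2 : ℝ)))
    (hPf : ∀ ρ σ : ℝ, 0 < ρ → ρ ≤ σ → ∀ h : L2C, P σ h = heat (σ - ρ) (P ρ h))
    {M : ℝ} (hM : 0 ≤ M) {g : ℝ → L2C} (hg : Continuous g) (hgb : ∀ s, ‖g s‖ ≤ M)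
    (hgr : ∀ s, IsReal (J (g s)) ∧ IsFourierDivFree (J (g s))) (ga : L2C) (τ : ℝ) :
    Continuous fun t => heat (max 0 (min t τ)) ga +
      ∫ s in (0 : ℝ)..max 0 (min t τ), P (max 0 (min t τ) - s) (L (Bop (J (g s)) (J (g s)))) := by
  have hc : Continuous fun t : ℝ => max 0 (min t τ) :=
    continuous_const.max (continuous_id.min continuous_const)
  have hGc := continuous_lift_bop hK hB9 hBadd hJn hLsub hM hg hgb hgr
  have hGb : ∀ s, ‖L (Bop (J (g s)) (J (g s)))‖ ≤ K * (M * M) := fun s =>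
    (norm_lift_bop_le hK hB9 hJn hLn (hgr s)).trans
      (mul_le_mul_of_nonneg_left (mul_le_mul (hgb _) (hgb _) (norm_nonneg _) hM) hK)
  have hD : ContinuousOn (fun r => ∫ s in (0 : ℝ)..r, P (r - s) (L (Bop (J (g s)) (J (g s)))))
      (Ici 0) := by
    refine (continuousOn_duhamel hPb hPf hGc (by positivity) hGb).congr fun r _ => ?_
    exact integral_smoothing_comp_sub P _ r
  exact (continuous_heat₂.comp₂ hc continuous_const).add
    (hD.comp_continuous hc fun t => Set.mem_Ici.2 (le_max_left _ _))

/-- **The contraction estimate**: for two admissible curves with `‖g − g'‖ ≤ δ` pointwise,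
`‖Φ(g)(t) − Φ(g')(t)‖ ≤ 2KMη·δ` at every clock value `r ∈ [0, τ]`. -/
theorem norm_phi_sub_phi_le {Bop : L2C → L2C → L2C} {K : ℝ} (hK : 0 ≤ K)
    (hB9 : ∀ u v : L2C, MemH10df u → MemH10df v → eFourierSobolevNorm 9 (Bop u v) ≤
      ENNReal.ofReal K * eFourierSobolevNorm 10 u * eFourierSobolevNorm 10 v)
    (hBadd : ∀ u u' v : L2C, MemH10df u → MemH10df u' → MemH10df v →
      Bop (u + u') v = Bop u v + Bop u' v ∧ Bop v (u + u') = Bop v u + Bop v u')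
    {J : L2C →L[ℂ] L2C} (hJn : ∀ h : L2C, eFourierSobolevNorm 10 (J h) = ‖h‖ₑ)
    {L : L2C → L2C}
    (hLsub : ∀ F F' : L2C, eFourierSobolevNorm 9 F < ⊤ → eFourierSobolevNorm 9 F' < ⊤ →
      ‖L F - L F'‖ₑ = eFourierSobolevNorm 9 (F - F'))
    (hLn : ∀ F : L2C, eFourierSobolevNorm 9 F < ⊤ → ‖L F‖ₑ = eFourierSobolevNorm 9 F)
    {P : ℝ → (L2C →L[ℂ] L2C)} (hPb : ∀ σ : ℝ, 0 < σ → ‖P σ‖ ≤ 1 + σ ^ (-(1 / 2 : ℝ)))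
    (hPf : ∀ ρ σ : ℝ, 0 < ρ → ρ ≤ σ → ∀ h : L2C, P σ h = heat (σ - ρ) (P ρ h))
    {M : ℝ} (hM : 0 ≤ M) {g g' : ℝ → L2C} (hg : Continuous g) (hgb : ∀ s, ‖g s‖ ≤ M)
    (hgr : ∀ s, IsReal (J (g s)) ∧ IsFourierDivFree (J (g s)))
    (hg' : Continuous g') (hgb' : ∀ s, ‖g' s‖ ≤ M)
    (hgr' : ∀ s, IsReal (J (g' s)) ∧ IsFourierDivFree (J (g' s)))
    {δ : ℝ} (hδ0 : 0 ≤ δ) (hδ : ∀ s, ‖g s - g' s‖ ≤ δ) (ga : L2C) {τ η : ℝ}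
    (hβ : ∀ r ∈ Icc (0 : ℝ) τ, |∫ σ in (0 : ℝ)..r, (1 + σ ^ (-(1 / 2 : ℝ)))| ≤ η)
    {r : ℝ} (hr : r ∈ Icc (0 : ℝ) τ) :
    ‖(heat r ga + ∫ s in (0 : ℝ)..r, P (r - s) (L (Bop (J (g s)) (J (g s))))) -
        (heat r ga + ∫ s in (0 : ℝ)..r, P (r - s) (L (Bop (J (g' s)) (J (g' s)))))‖ ≤
      2 * K * M * η * δ := by
  have hI := intervalIntegrable_phi hK hB9 hBadd hJn hLsub hLn hPb hPf hM hg hgb hgr hr.1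
  have hI' := intervalIntegrable_phi hK hB9 hBadd hJn hLsub hLn hPb hPf hM hg' hgb' hgr' hr.1
  rw [add_sub_add_left_eq_sub, ← intervalIntegral.integral_sub hI hI']
  have h3 : (fun s => P (r - s) (L (Bop (J (g s)) (J (g s)))) - P (r - s) (L (Bop (J (g' s)) (J (g' s))))) =
      fun s => P (r - s) ((fun x => L (Bop (J (g x)) (J (g x))) - L (Bop (J (g' x)) (J (g' x)))) s) := by
    funext s
    rw [map_sub]
  rw [h3, integral_smoothing_comp_sub]
  refine (norm_integral_smoothing_le hPb r
    (fun x => L (Bop (J (g x)) (J (g x))) - L (Bop (J (g' x)) (J (g' x)))) le_rfl hr.1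
    (N := 2 * K * M * δ) (by positivity) fun σ _ => ?_).trans ?_
  · calc ‖L (Bop (J (g (r - σ))) (J (g (r - σ)))) - L (Bop (J (g' (r - σ))) (J (g' (r - σ))))‖
        ≤ K * (‖g (r - σ) - g' (r - σ)‖ * ‖g (r - σ)‖) +
          K * (‖g' (r - σ)‖ * ‖g (r - σ) - g' (r - σ)‖) :=
          norm_lift_bop_sub_le hK hB9 hBadd hJn hLsub (hgr _) (hgr' _)
      _ ≤ K * (δ * M) + K * (M * δ) := by
          gcongr
          · exact hδ _
          · exact hgb _
          · exact hgb' _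
          · exact hδ _
      _ = 2 * K * M * δ := by ring
  · calc 2 * K * M * δ * |∫ σ in (0 : ℝ)..r, (1 + σ ^ (-(1 / 2 : ℝ)))| ≤ 2 * K * M * δ * η :=
          mul_le_mul_of_nonneg_left (hβ r hr) (by positivity)
      _ = 2 * K * M * η * δ := by ring

end E

open Literature.Analysis.FluidPDE Literature.Analysis.FluidPDE.Tao2016
open Literature.Analysis.FunctionSpaces (eFourierSobolevNorm)

/-- **Registered sub-goal `stub_localExistence_Step`** of stub E (`localExistence`): the lifted
forcing `x ↦ L(Bop(Jx, Jx))` of the Picard scheme is locally Lipschitz on `L²`,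
`‖L(Bop(Jx,Jx)) − L(Bop(Jy,Jy))‖ ≤ K(‖x−y‖‖x‖ + ‖y‖‖x−y‖)` (`E.norm_lift_bop_sub_le`). -/
theorem stub_localExistence_Step : ∀ (Bop : L2C → L2C → L2C) (K : ℝ) (J : L2C →L[ℂ] L2C) (L : L2C → L2C), 0 ≤ K → (∀ u v : L2C, MemH10df u → MemH10df v → eFourierSobolevNorm 9 (Bop u v) ≤ ENNReal.ofReal K * eFourierSobolevNorm 10 u * eFourierSobolevNorm 10 v) → (∀ u u' v : L2C, MemH10df u → MemH10df u' → MemH10df v → Bop (u + u') v = Bop u v + Bop u' v ∧ Bop v (u + u') = Bop v u + Bop v u') → (∀ h : L2C, eFourierSobolevNorm 10 (J h) = ‖h‖ₑ) → (∀ F F' : L2C, eFourierSobolevNorm 9 F < ⊤ → eFourierSobolevNorm 9 F' < ⊤ → ‖L F - L F'‖ₑ = eFourierSobolevNorm 9 (F - F')) → ∀ x y : L2C, IsReal (J x) ∧ IsFourierDivFree (J x) → IsReal (J y) ∧ IsFourierDivFree (J y) → ‖L (Bop (J x) (J x)) - L (Bop (J y) (J y))‖ ≤ K * (‖x - y‖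 * ‖x‖) + K * (‖y‖ * ‖x - y‖) :=
  fun _ _ _ _ hK hB9 hBadd hJn hLsub _ _ hx hy => E.norm_lift_bop_sub_le hK hB9 hBadd hJn hLsub hx hy

end Summit.NavierStokesRegularity.NavierStokesRegularity.Theorems.PerpetualPumpThesis
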